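import Summits.Ventures.PercRepro.C041ZoneOneVertexDefs

/-!
# THEOREM (ONE MARKED VERTEX) — the one-anchor (CS) and the ZONE O-CUBE on every zone whose terminal edges sit at
one vertex (mine-3, gen 58; C-041.md §19 (j))

Setting and vocabulary of `C041ZoneOneVertexDefs`: a zone `Z : ZoneData V E T₁ T₂` (p6's `ZoneZ` model), a single
anchor `k`, ANY multigraph (cycles allowed), all terminal edges at ONE vertex `v` (`∀ i, Z.at₁ i = v`,
`∀ j, Z.at₂ j = v`).  THEOREM: the count form of the one-anchor (CS) holds, `(#F − #I)² ≤ #T₁ · #T₂`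
(`oneVertex_cs`), hence `Z.ZoneCSConj {k} ∅` and `Z.ZoneOCubeConj {k} ∅` (`oneVertex_zoneCSConj`,
`oneVertex_zoneOCubeConj`; `oneVertex_oCube` is the count form `2·#F ≤ #T₁ + #T₂ + 2·#I`).

PROOF (C-041.md §19 (j)).  For a fixed edge colouring `ω` the admissible mark patterns are counted class by class
(`fibre_F_of_Mg` … `fibre_I_of_not_Rd`): the anchor's sub-zone carries `v`'s marks iff `v` is merged (`Mg ω`),
the red reach sees them iff `v` is reached (`Rd ω`).  The four classes `x` (merged, not reached), `y` (separated,
reached), `z` (merged and reached — the cycle class, empty on a tree), `w` (neither) are exchanged by the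
edge-complementation, so `x = y` (`xOV_eq_yOV`).  Summing the fibres (`card_Fset_ov`, `card_T1set_ov`,
`card_T2set_ov`, `card_Iset_ov`): `#F = (x + z)·1 + (x + w)·nAdm`, `#I = (x + z)·J + (x + w)·nAdm`,
`#T₁ = (x + z)·t₁`, `#T₂ = (x + z)·t₂` with `J ≤ 1` and `J = 0 → 1 ≤ t₁, t₂`; hence `#I ≤ #F` and
`(#F − #I)² = (x + z)²·(1 − J)² ≤ (x + z)²·t₁·t₂`.
-/

namespace PercRepro

namespace ZoneZ

namespace ZoneData

open Finset

variable {V E T₁ T₂ : Type*} (Z : ZoneData V E T₁ T₂) (k v : V)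

/-! ## The fibres of the four count sets over an edge colouring -/

section Fibres

variable [Fintype E] [DecidableEq E] [Fintype T₁] [DecidableEq T₁] [Fintype T₂] [DecidableEq T₂]
variable (h1 : ∀ i, Z.at₁ i = v) (h2 : ∀ j, Z.at₂ j = v)
include h1 h2

/-- Over a colouring with `v` merged, the only `F`-pattern is all red. -/
theorem fibre_F_of_Mg (ω : E → Bool) (hm : Z.Mg k v ω) :
    #(univ.filter fun μ : (T₁ → Bool) × (T₂ → Bool) => (ω, μ) ∈ Z.Fset k) = 1 := by
  rw [Finset.card_eq_one]
  refine ⟨(fun _ => true, fun _ => true), ?_⟩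
  ext μ
  simp only [mem_filter, mem_univ, true_and, mem_singleton, Z.mem_Fset, Z.adm_iff_ov v h1 h2,
    Z.mem_D_iff_ov k v h1 h2, Z.mem_D2_iff_ov k v h1 h2, hm, not_exists, Bool.not_eq_false]
  constructor
  · rintro ⟨-, h1', h2'⟩
    exact Prod.ext (funext h1') (funext h2')
  · rintro rfl
    simp

/-- Over a colouring with `v` separated, every admissible pattern is an `F`-pattern. -/
theorem fibre_F_of_not_Mg (ω : E → Bool) (hm : ¬ Z.Mg k v ω) :
    #(univ.filter fun μ : (T₁ → Bool) × (T₂ → Bool) => (ω, μ) ∈ Z.Fset k) = nAdmOV T₁ T₂ := by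
  unfold nAdmOV
  congr 1
  ext μ
  simp only [mem_filter, mem_univ, true_and, Z.mem_Fset, Z.adm_iff_ov v h1 h2,
    Z.mem_D_iff_ov k v h1 h2, Z.mem_D2_iff_ov k v h1 h2, hm, false_and, not_false_eq_true, and_true]

/-- Over a colouring with `v` merged, the `T₁`-patterns are the type-1 patterns at `v`. -/
theorem fibre_T1_of_Mg (ω : E → Bool) (hm : Z.Mg k v ω) :
    #(univ.filter fun μ : (T₁ → Bool) × (T₂ → Bool) => (ω, μ) ∈ Z.T1set k) = nT1OV T₁ T₂ := by
  unfold nT1OV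
  congr 1
  ext μ
  simp only [mem_filter, mem_univ, true_and, Z.mem_T1set, Z.adm_iff_ov v h1 h2,
    Z.mem_D_iff_ov k v h1 h2, hm, true_and]
  tauto

/-- Over a colouring with `v` separated, there is no `T₁`-pattern. -/
theorem fibre_T1_of_not_Mg (ω : E → Bool) (hm : ¬ Z.Mg k v ω) :
    #(univ.filter fun μ : (T₁ → Bool) × (T₂ → Bool) => (ω, μ) ∈ Z.T1set k) = 0 := by
  rw [Finset.card_eq_zero, Finset.filter_eq_empty_iff]
  intro μ _
  simp only [Z.mem_T1set, Z.mem_D_iff_ov k v h1 h2, hm, false_and, and_false, not_false_eq_true]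

/-- Over a colouring with `v` merged, the `T₂`-patterns are the type-2 patterns at `v`. -/
theorem fibre_T2_of_Mg (ω : E → Bool) (hm : Z.Mg k v ω) :
    #(univ.filter fun μ : (T₁ → Bool) × (T₂ → Bool) => (ω, μ) ∈ Z.T2set k) = nT2OV T₁ T₂ := by
  unfold nT2OV
  congr 1
  ext μ
  simp only [mem_filter, mem_univ, true_and, Z.mem_T2set, Z.adm_iff_ov v h1 h2,
    Z.mem_D2_iff_ov k v h1 h2, hm, true_and]
  tauto

/-- Over a colouring with `v` separated, there is no `T₂`-pattern. -/
theorem fibre_T2_of_not_Mg (ω : E → Bool) (hm : ¬ Z.Mg k v ω) :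
    #(univ.filter fun μ : (T₁ → Bool) × (T₂ → Bool) => (ω, μ) ∈ Z.T2set k) = 0 := by
  rw [Finset.card_eq_zero, Finset.filter_eq_empty_iff]
  intro μ _
  simp only [Z.mem_T2set, Z.mem_D2_iff_ov k v h1 h2, hm, false_and, and_false, not_false_eq_true]

/-- Over a colouring with `v` reached, the invalid patterns are the admissible all-blue ones. -/
theorem fibre_I_of_Rd (ω : E → Bool) (hr : Z.Rd k v ω) :
    #(univ.filter fun μ : (T₁ → Bool) × (T₂ → Bool) => (ω, μ) ∈ Z.Iset k) = nJOV T₁ T₂ := by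
  unfold nJOV
  congr 1
  ext μ
  simp only [mem_filter, mem_univ, true_and, Z.mem_Iset, Z.adm_iff_ov v h1 h2,
    Z.blueK_iff_ov k v h1 h2, hr, true_and]

/-- Over a colouring with `v` not reached, every admissible pattern is invalid. -/
theorem fibre_I_of_not_Rd (ω : E → Bool) (hr : ¬ Z.Rd k v ω) :
    #(univ.filter fun μ : (T₁ → Bool) × (T₂ → Bool) => (ω, μ) ∈ Z.Iset k) = nAdmOV T₁ T₂ := by
  unfold nAdmOV
  congr 1
  ext μ
  simp only [mem_filter, mem_univ, true_and, Z.mem_Iset, Z.adm_iff_ov v h1 h2,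
    Z.blueK_iff_ov k v h1 h2, hr, false_and, not_false_eq_true, and_true]

end Fibres

/-! ## The four classes of edge colourings and the complementation involution -/

section Classes

variable [Fintype E] [DecidableEq E]

open Classical in
/-- `x`: the colourings with `v` merged and not reached. -/
noncomputable def xOV : ℕ := #(univ.filter fun ω : E → Bool => Z.Mg k v ω ∧ ¬ Z.Rd k v ω)

open Classical in
/-- `y`: the colourings with `v` separated and reached. -/
noncomputable def yOV : ℕ := #(univ.filter fun ω : E → Bool => ¬ Z.Mg k v ω ∧ Z.Rd k v ω)

open Classical in
/-- `z`: the colourings with `v` merged and reached (the cycle class). -/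
noncomputable def zOV : ℕ := #(univ.filter fun ω : E → Bool => Z.Mg k v ω ∧ Z.Rd k v ω)

open Classical in
/-- `w`: the colourings with `v` separated and not reached. -/
noncomputable def wOV : ℕ := #(univ.filter fun ω : E → Bool => ¬ Z.Mg k v ω ∧ ¬ Z.Rd k v ω)

open Classical in
/-- **The complementation involution**: «merged, not reached» and «separated, reached» are equinumerous. -/
theorem xOV_eq_yOV : Z.xOV k v = Z.yOV k v := by
  unfold xOV yOV
  apply card_eq_of_involutive cpl cpl_cpl
  · intro ω hω
    simp only [mem_filter, mem_univ, true_and] at hω ⊢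
    rw [Z.Mg_cpl, Z.Rd_cpl]
    exact ⟨hω.2, hω.1⟩
  · intro ω hω
    simp only [mem_filter, mem_univ, true_and] at hω ⊢
    rw [Z.Mg_cpl, Z.Rd_cpl]
    exact ⟨hω.2, hω.1⟩

open Classical in
/-- The merged colourings are `x + z`. -/
theorem card_filter_Mg : #(univ.filter fun ω : E → Bool => Z.Mg k v ω) = Z.xOV k v + Z.zOV k v := by
  unfold xOV zOV
  rw [← Finset.card_filter_add_card_filter_not (s := univ.filter fun ω : E → Bool => Z.Mg k v ω)
    (fun ω => Z.Rd k v ω), Finset.filter_filter, Finset.filter_filter, add_comm]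

open Classical in
/-- The separated colourings are `y + w`. -/
theorem card_filter_not_Mg : #(univ.filter fun ω : E → Bool => ¬ Z.Mg k v ω) = Z.yOV k v + Z.wOV k v := by
  unfold yOV wOV
  rw [← Finset.card_filter_add_card_filter_not (s := univ.filter fun ω : E → Bool => ¬ Z.Mg k v ω)
    (fun ω => Z.Rd k v ω), Finset.filter_filter, Finset.filter_filter]

open Classical in
/-- The reached colourings are `y + z`. -/
theorem card_filter_Rd : #(univ.filter fun ω : E → Bool => Z.Rd k v ω) = Z.yOV k v + Z.zOV k v := by
  unfold yOV zOV
  rw [← Finset.card_filter_add_card_filter_not (s := univ.filter fun ω : E → Bool => Z.Rd k v ω)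
    (fun ω => Z.Mg k v ω), Finset.filter_filter, Finset.filter_filter, add_comm]
  congr 2
  · ext ω
    simp only [mem_filter, mem_univ, true_and, and_comm]
  · ext ω
    simp only [mem_filter, mem_univ, true_and, and_comm]

open Classical in
/-- The unreached colourings are `x + w`. -/
theorem card_filter_not_Rd : #(univ.filter fun ω : E → Bool => ¬ Z.Rd k v ω) = Z.xOV k v + Z.wOV k v := by
  unfold xOV wOV
  rw [← Finset.card_filter_add_card_filter_not (s := univ.filter fun ω : E → Bool => ¬ Z.Rd k v ω)
    (fun ω => Z.Mg k v ω), Finset.filter_filter, Finset.filter_filter]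
  congr 2
  · ext ω
    simp only [mem_filter, mem_univ, true_and, and_comm]
  · ext ω
    simp only [mem_filter, mem_univ, true_and, and_comm]

open Classical in
/-- A sum over the colourings that depends on `Mg` only. -/
theorem sum_ite_Mg (a b : ℕ) :
    ∑ ω : E → Bool, (if Z.Mg k v ω then a else b) = (Z.xOV k v + Z.zOV k v) * a + (Z.yOV k v + Z.wOV k v) * b := by
  rw [Finset.sum_ite, Finset.sum_const, Finset.sum_const, smul_eq_mul, smul_eq_mul, Z.card_filter_Mg,
    Z.card_filter_not_Mg]

open Classical in
/-- A sum over the colourings that depends on `Rd` only. -/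
theorem sum_ite_Rd (a b : ℕ) :
    ∑ ω : E → Bool, (if Z.Rd k v ω then a else b) = (Z.yOV k v + Z.zOV k v) * a + (Z.xOV k v + Z.wOV k v) * b := by
  rw [Finset.sum_ite, Finset.sum_const, Finset.sum_const, smul_eq_mul, smul_eq_mul, Z.card_filter_Rd,
    Z.card_filter_not_Rd]

end Classes

/-! ## The four counts and THEOREM (ONE MARKED VERTEX) -/

section Main

variable [Fintype E] [DecidableEq E] [Fintype T₁] [DecidableEq T₁] [Fintype T₂] [DecidableEq T₂]
variable (h1 : ∀ i, Z.at₁ i = v) (h2 : ∀ j, Z.at₂ j = v)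
include h1 h2

/-- `#F = (x + z)·1 + (y + w)·nAdm`. -/
theorem card_Fset_ov : #(Z.Fset k) = (Z.xOV k v + Z.zOV k v) * 1 + (Z.yOV k v + Z.wOV k v) * nAdmOV T₁ T₂ := by
  classical
  rw [card_eq_sum_fibres, ← Z.sum_ite_Mg k v]
  refine Finset.sum_congr rfl fun ω _ => ?_
  by_cases hm : Z.Mg k v ω
  · rw [if_pos hm]
    exact Z.fibre_F_of_Mg k v h1 h2 ω hm
  · rw [if_neg hm]
    exact Z.fibre_F_of_not_Mg k v h1 h2 ω hm

/-- `#T₁ = (x + z)·t₁`. -/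
theorem card_T1set_ov : #(Z.T1set k) = (Z.xOV k v + Z.zOV k v) * nT1OV T₁ T₂ + (Z.yOV k v + Z.wOV k v) * 0 := by
  classical
  rw [card_eq_sum_fibres, ← Z.sum_ite_Mg k v]
  refine Finset.sum_congr rfl fun ω _ => ?_
  by_cases hm : Z.Mg k v ω
  · rw [if_pos hm]
    exact Z.fibre_T1_of_Mg k v h1 h2 ω hm
  · rw [if_neg hm]
    exact Z.fibre_T1_of_not_Mg k v h1 h2 ω hm

/-- `#T₂ = (x + z)·t₂`. -/
theorem card_T2set_ov : #(Z.T2set k) = (Z.xOV k v + Z.zOV k v) * nT2OV T₁ T₂ + (Z.yOV k v + Z.wOV k v) * 0 := by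
  classical
  rw [card_eq_sum_fibres, ← Z.sum_ite_Mg k v]
  refine Finset.sum_congr rfl fun ω _ => ?_
  by_cases hm : Z.Mg k v ω
  · rw [if_pos hm]
    exact Z.fibre_T2_of_Mg k v h1 h2 ω hm
  · rw [if_neg hm]
    exact Z.fibre_T2_of_not_Mg k v h1 h2 ω hm

/-- `#I = (y + z)·J + (x + w)·nAdm`. -/
theorem card_Iset_ov : #(Z.Iset k) = (Z.yOV k v + Z.zOV k v) * nJOV T₁ T₂ + (Z.xOV k v + Z.wOV k v) * nAdmOV T₁ T₂ := by
  classical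
  rw [card_eq_sum_fibres, ← Z.sum_ite_Rd k v]
  refine Finset.sum_congr rfl fun ω _ => ?_
  by_cases hr : Z.Rd k v ω
  · rw [if_pos hr]
    exact Z.fibre_I_of_Rd k v h1 h2 ω hr
  · rw [if_neg hr]
    exact Z.fibre_I_of_not_Rd k v h1 h2 ω hr

/-- The invalid states are at most the all-red states. -/
theorem card_Iset_le_card_Fset_ov : #(Z.Iset k) ≤ #(Z.Fset k) := by
  rw [Z.card_Fset_ov k v h1 h2, Z.card_Iset_ov k v h1 h2, ← Z.xOV_eq_yOV k v]
  have hJ := nJOV_le_one (T₁ := T₁) (T₂ := T₂)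
  nlinarith [Nat.zero_le (Z.xOV k v), Nat.zero_le (Z.zOV k v)]

/-- **THEOREM (ONE MARKED VERTEX), count form**: on every zone whose terminal edges all sit at one vertex `v`,
the one-anchor (CS) holds: `(#F − #I)² ≤ #T₁ · #T₂`. -/
theorem oneVertex_cs : (#(Z.Fset k) - #(Z.Iset k)) ^ 2 ≤ #(Z.T1set k) * #(Z.T2set k) := by
  rw [Z.card_Fset_ov k v h1 h2, Z.card_Iset_ov k v h1 h2, Z.card_T1set_ov k v h1 h2,
    Z.card_T2set_ov k v h1 h2, ← Z.xOV_eq_yOV k v]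
  have hJ := nJOV_le_one (T₁ := T₁) (T₂ := T₂)
  rcases Nat.le_one_iff_eq_zero_or_eq_one.1 hJ with hJ0 | hJ1
  · have ht1 := one_le_nT1OV_of_nJOV hJ0
    have ht2 := one_le_nT2OV_of_nJOV hJ0
    rw [hJ0]
    have e : (Z.xOV k v + Z.zOV k v) * 1 + (Z.xOV k v + Z.wOV k v) * nAdmOV T₁ T₂ -
        ((Z.xOV k v + Z.zOV k v) * 0 + (Z.xOV k v + Z.wOV k v) * nAdmOV T₁ T₂) = Z.xOV k v + Z.zOV k v := by
      omega
    rw [e]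
    simp only [mul_zero, add_zero]
    have h12 : 1 * 1 ≤ nT1OV T₁ T₂ * nT2OV T₁ T₂ := Nat.mul_le_mul ht1 ht2
    calc (Z.xOV k v + Z.zOV k v) ^ 2 = (Z.xOV k v + Z.zOV k v) ^ 2 * (1 * 1) := by ring
      _ ≤ (Z.xOV k v + Z.zOV k v) ^ 2 * (nT1OV T₁ T₂ * nT2OV T₁ T₂) := Nat.mul_le_mul_left _ h12
      _ = (Z.xOV k v + Z.zOV k v) * nT1OV T₁ T₂ * ((Z.xOV k v + Z.zOV k v) * nT2OV T₁ T₂) := by ring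
  · rw [hJ1]
    have e : (Z.xOV k v + Z.zOV k v) * 1 + (Z.xOV k v + Z.wOV k v) * nAdmOV T₁ T₂ -
        ((Z.xOV k v + Z.zOV k v) * 1 + (Z.xOV k v + Z.wOV k v) * nAdmOV T₁ T₂) = 0 := by
      omega
    rw [e]
    simp

/-- **THEOREM (ONE MARKED VERTEX)**: the abstract one-anchor (CS) `ZoneCSConj {k} ∅` holds on every zone whose
terminal edges all sit at one vertex. -/
theorem oneVertex_zoneCSConj : Z.ZoneCSConj {k} (∅ : Set V) :=
  (Z.zoneCSConj_single_iff k).2 (Z.oneVertex_cs k v h1 h2)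

/-- **THEOREM (ONE MARKED VERTEX)**: the ZONE O-CUBE `ZoneOCubeConj {k} ∅` holds on every zone whose terminal
edges all sit at one vertex. -/
theorem oneVertex_zoneOCubeConj : Z.ZoneOCubeConj {k} (∅ : Set V) :=
  Z.zoneOCubeConj_of_zoneCS {k} ∅ (Z.oneVertex_zoneCSConj k v h1 h2)

/-- The count form of the ZONE O-CUBE on such a zone: `2·#F ≤ #T₁ + #T₂ + 2·#I`. -/
theorem oneVertex_oCube : 2 * #(Z.Fset k) ≤ #(Z.T1set k) + #(Z.T2set k) + 2 * #(Z.Iset k) :=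
  (Z.zoneOCubeConj_single_iff k).1 (Z.oneVertex_zoneOCubeConj k v h1 h2)

end Main

end ZoneData

end ZoneZ

end PercRepro
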